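import Summits.Schanuel.Schanuel.Theorems.RootDecomp1KHeightMachine02

/-!
# RootDecomp1KHeightMachine — lens 1, generation 53, NODE 13 «THE HEIGHT MACHINE ON THE LINE: node 12's antecedent DISCHARGED, HYPOTHESIS-FREE, on the two ℙ¹-uniformised territory classes» (RULE K-R42 (vii′), K-R44) — continuation (RootDecomp1KHeightMachine03): §5 the class-I member M13 and its costume test

(lens-1 g53 NODE 13 HOME kernel K = HOME/decomp-schanuel-lens-1/g53/HeightMachine.lean eb09d600…, 1515 l, 171 thm + 12 def, imports tree …RootDecomp1KHeightGrading04 + Literature.NumberTheory.DiophantineGeometry.RationalFunctionHeight ONLY; Probe / Ctrl0 / Ctrl + NODE-g53.md + SHA256SUMS + the lens's K-R44 certificate g53/liveness/ (census instrument liveness3.py); CLAIM L2587, crit EX-ANTE PRICE L2588 (ONE THEOREM ×1 under RULE K-R42 (vii′) «an infinite territory class becomes UNCONDITIONAL» iff CHECKLIST K-g53; RULE K-R44 liveness certificate), NODE L2595 / REQUEST L2596, census STAGING NOTE 3 L2597 + CONFIRM L2598 (L13 liveness row; dedup pre-scan 0 homonyms), critic VERDICT L2599: CLEARED — THEOREM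 ×1 under RULE K-R42 (vii′) (A⁺ ∧ A′ jointly; the (P2) label earned inside the credit by L13); CHECKLIST K-g53 met; RULE K-R44 fixed with the census instrument LIVENESS-v3 as certificate format; PORT GO (credit port, verbatim; conditions: dedup scan clean, provenance block, cite-token spelling). Port by census-1 gen 22 as `RootDecomp1KHeightMachine01–05` (`--supports stmt-Schanuel-33364`; no census credit): 01 = §1 the INPUT `exists_logHt_div_sub_le` (Silverman AEC VIII.5.6 on ℙ¹ over ℚ — the tree's PROVED Literature theorem `exists_abs_logHeight₁_div_sub_le_finrank` at k = K = ℚ through node 12's `logHt_eq_logHeight₁`; NO binder, NO hypothesis def) + §2 the two transfer tails (`clause_of_transfer`, `not_clause_of_transfer(_le)`, boundary tail `not_clause_of_upper_height_le`); 02 = §3 CLASS I correspondence curves **`thinFibreAt_of_corr`** (A⁺) / `thinFibreAt_iff_bddLevelEmpty_of_corr(_le)` (B⁺, B⁼) / `thinFibreAt_or_iff_bddLevelEmpty_of_corr` + `CorrAt`, `corrP` + §4 CLASS II ℚ-parametrised curves **`thinFibreAt_of_param`** (A′) / B′ / B′⁼ + `ParamAt`; 03 = §5 the class-I member `M13` (illustration;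 costume test at m₀ = 2, 3); 04 = §5b the LIVE class-I member `L13` (K-R44 certificate LIFTS; costume test); 05 = §6 the class-II member `R13` (x = t³ + t, y = t + 1/t; LIFTS, exp 1/3) + §7 the residual of record RE-GRADED ×0 (`MachineDecidedAt`, `MachineOffAt`, `MachineHeightOffAt`, `thinFibre_of_machineOffAt`, …). PORT EDITS: none needed on decls (K fully documented, no private, no set_option, no cite-token); provenance doc blocks + continuation headers = K's own open-lines only; statements and proofs VERBATIM. Rung 0 — nothing here proves Schanuel, 33364, 33363, 31077 or ThinFibre 2; classes I/II are HYPOTHESIS-FREE, the rest of §7 is conditional on PadicSubspace / HeightComparison.)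
-/

noncomputable section

namespace Summit.Schanuel.Schanuel.Theorems.RootDecomp1KHeightMachine

open Polynomial LiouvilleNumber
open scoped Nat
open Summit.Schanuel.Schanuel.Theorems.RootDecomp1KSkelCell (SkelLiouvilleFix)
open Summit.Schanuel.Schanuel.Theorems.RootDecomp1KTwoBaseCell (psNumer partialSum_eq_psNumer_div coprime_psNumer
  partialSum_pos' partialSum_lt_two)
open Summit.Schanuel.Schanuel.Theorems.RootDecomp1KDegreeLadder
open Summit.Schanuel.Schanuel.Theorems.RootDecomp1KXLinearCore
open Summit.Schanuel.Schanuel.Theorems.RootDecomp1KXLinear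
open Summit.Schanuel.Schanuel.Theorems.RootDecomp1KXLinearII
open Summit.Schanuel.Schanuel.Theorems.RootDecomp1KXTop
open Summit.Schanuel.Schanuel.Theorems.RootDecomp1KXAll
open Summit.Schanuel.Schanuel.Theorems.RootDecomp1KLevelFinite
open Summit.Schanuel.Schanuel.Theorems.RootDecomp1KSubspaceBranch
open Summit.Schanuel.Schanuel.Theorems.RootDecomp1KHeightGrading

/-! ### §5  The class-I member `M13 = x²·Y² + x·(Y³ + 2) + (2Y³ + Y² + 4) = (Y³ + 2)(x² + x + 3) − (Y³ − Y² + 2)(x² + 1)`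
(`f(y) = (y³+2)/(y³−y²+2) = g(x) = (x²+1)/(x²+x+3)`, `dF = 3 < 2·2 = m₀·dG` at `m₀ = 2`) and its COSTUME TEST BY NAME -/

/-- the `x`-coefficients of `M13`: `c₂ = Y²` (INSEPARABLE top, double root `0 ∈ ℚ₂`: `μ_ℚ₂ = 2`), `c₁ = Y³ + 2`,
`c₀ = 2Y³ + Y² + 4` (full `x`-support). -/
def m13C : ℕ → ℤ[X] := fun j =>
  if j = 2 then X ^ 2 else if j = 1 then X ^ 3 + Polynomial.C 2 else Polynomial.C 2 * X ^ 3 + X ^ 2 + Polynomial.C 4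

/-- **THE CLASS-I MEMBER** `M13 = x²·Y² + x·(Y³ + 2) + (2Y³ + Y² + 4) ∈ ℤ[x][Y]`: `xdeg = 2`, `deg_Y = 3`. -/
def M13 : ℤ[X][X] := xPolyP 2 m13C

/-- `m13C 2 = X ^ 2`. -/
theorem m13C_two : m13C 2 = X ^ 2 := by simp [m13C]
/-- `m13C 1 = X ^ 3 + C 2`. -/
theorem m13C_one : m13C 1 = X ^ 3 + Polynomial.C 2 := by simp [m13C]
/-- `m13C 0 = C 2 * X ^ 3 + X ^ 2 + C 4`. -/
theorem m13C_zero : m13C 0 = Polynomial.C 2 * X ^ 3 + X ^ 2 + Polynomial.C 4 := by simp [m13C]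
/-- `{j : ℕ} (hj : 3 ≤ j) : m13C j = C 2 * X ^ 3 + X ^ 2 + C 4` (unused indices). -/
theorem m13C_of_ge {j : ℕ} (hj : 3 ≤ j) : m13C j = Polynomial.C 2 * X ^ 3 + X ^ 2 + Polynomial.C 4 := by
  simp [m13C, show j ≠ 2 by omega, show j ≠ 1 by omega]

/-- `(m13C 2).natDegree = 2`. -/
theorem natDegree_m13C_two : (m13C 2).natDegree = 2 := by rw [m13C_two, natDegree_X_pow]
/-- `(m13C 1).natDegree = 3`. -/
theorem natDegree_m13C_one : (m13C 1).natDegree = 3 := by rw [m13C_one, natDegree_X_pow_add_C]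
/-- `(m13C 0).natDegree = 3`. -/
theorem natDegree_m13C_zero : (m13C 0).natDegree = 3 := by rw [m13C_zero]; compute_degree!
/-- `m13C 2 ≠ 0`. -/
theorem m13C_two_ne_zero : m13C 2 ≠ 0 := by rw [m13C_two]; exact pow_ne_zero _ X_ne_zero

/-- `(j : ℕ) : (m13C j).natDegree ≤ 3`. -/
theorem natDegree_m13C_le (j : ℕ) : (m13C j).natDegree ≤ 3 := by
  rcases Nat.lt_or_ge j 3 with hj | hj
  · interval_cases j
    · rw [natDegree_m13C_zero]
    · rw [natDegree_m13C_one]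
    · rw [natDegree_m13C_two]; norm_num
  · rw [m13C_of_ge hj]; compute_degree!

/-- NO `x`-exponent of `M13` is missing (`c_j(1) = 7, 3, 1`): not two-term, `x`-gap `γ = 1` only. -/
theorem m13C_ne_zero {j : ℕ} (hj : j ≤ 2) : m13C j ≠ 0 := by
  intro h
  have h0 := congrArg (fun q : ℤ[X] => q.eval 1) h
  interval_cases j <;> simp [m13C_zero, m13C_one, m13C_two] at h0

/-- `xdeg M13 = 2`. -/
theorem xdeg_M13 : xdeg M13 = 2 := xdeg_xPolyP 2 m13C m13C_two_ne_zero

/-- `topX M13 = Y²`. -/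
theorem topX_M13 : topX M13 = m13C 2 := topX_xPolyP 2 m13C m13C_two_ne_zero

/-- the `x¹Y³`-coefficient of `M13` is `1`. -/
theorem coeff_coeff_M13_three_one : (M13.coeff 3).coeff 1 = 1 := by
  rw [M13, coeff_coeff_xPolyP, if_pos (by simp), m13C_one, coeff_add, coeff_X_pow, coeff_C]
  simp

/-- `deg_Y M13 = 3`. -/
theorem natDegree_M13 : M13.natDegree = 3 := by
  refine le_antisymm (natDegree_xPolyP_le 2 m13C 3 fun j _ => natDegree_m13C_le j) ?_
  refine le_natDegree_of_ne_zero fun h => ?_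
  have h1 := coeff_coeff_M13_three_one
  rw [h, coeff_zero] at h1
  exact zero_ne_one h1

/-- the `x²Y²`-coefficient of `M13` is `1`. -/
theorem coeff_coeff_M13_two_two : (M13.coeff 2).coeff 2 = 1 := by
  rw [M13, coeff_coeff_xPolyP, if_pos (by simp), m13C_two, coeff_X_pow, if_pos rfl]

/-- `M13` is NOT a two-term curve `x^k·B(Y) − A(Y)`. -/
theorem M13_ne_twoTermP (k : ℕ) (B A : ℤ[X]) : M13 ≠ twoTermP k B A := by
  intro h
  have h1 := congrArg (fun Q : ℤ[X][X] => (Q.coeff 3).coeff 1) h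
  have h2 := congrArg (fun Q : ℤ[X][X] => (Q.coeff 2).coeff 2) h
  simp only [coeff_coeff_M13_three_one, coeff_coeff_M13_two_two, coeff_coeff_twoTermP] at h1 h2
  split_ifs at h1 h2 <;> omega

/-- `M13` is none of node 12b's bookkept members (`RootDecomp1KHeightGrading04`): `M13 ≠ B17P` (`deg_Y`: `3 ≠ 2`). -/
theorem M13_ne_B17P : M13 ≠ B17P := fun h => by
  have := natDegree_M13; rw [h, natDegree_B17P] at this; omega

/-- `M13 ≠ N2P` (`deg_Y`: `3 ≠ 2`). -/
theorem M13_ne_N2P : M13 ≠ N2P := fun h => by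
  have := natDegree_M13; rw [h, natDegree_N2P] at this; omega

/-- `M13 ≠ cuspP` (`cuspP = Y³ − x²` has no `x¹Y³`-term). -/
theorem M13_ne_cuspP : M13 ≠ cuspP := fun h => by
  have h1 := coeff_coeff_M13_three_one
  rw [h, cuspP, coeff_sub, coeff_C, if_neg (by norm_num), sub_zero, coeff_X_pow, if_pos rfl, coeff_one] at h1
  norm_num at h1

/-- `M13 ≠ 0`. -/
theorem M13_ne_zero : M13 ≠ 0 := fun h => by have := natDegree_M13; rw [h, natDegree_zero] at this; omega

/-- the evaluation `M13(x, y) = (2y³ + y² + 4) + x(y³ + 2) + x²y²`. -/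
theorem bev_M13 (x y : ℝ) : bev M13 x y = 2 * y ^ 3 + y ^ 2 + 4 + x * (y ^ 3 + 2) + x ^ 2 * y ^ 2 := by
  rw [M13, bev_xPolyP]
  simp [Finset.sum_range_succ, m13C_zero, m13C_one, m13C_two, map_ofNat]

/-- `M13(x, y) = (y³ + 2)(x² + x + 3) − (y³ − y² + 2)(x² + 1)` — a correspondence curve `f(y) = g(x)`. -/
theorem bev_M13_eq (x y : ℝ) :
    bev M13 x y = (y ^ 3 + 2) * (x ^ 2 + x + 3) - (y ^ 3 - y ^ 2 + 2) * (x ^ 2 + 1) := by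
  rw [bev_M13]; ring

/-- the class-I data of `M13` over `ℚ`: `F₁ = t³ + 2`, `F₂ = t³ − t² + 2`, `G₁ = t² + 1`, `G₂ = t² + t + 3`. -/
theorem rel_M13 (x y : ℚ) (h : bev M13 x y = 0) :
    aeval y (X ^ 3 + 2 : ℚ[X]) * aeval x (X ^ 2 + X + 3 : ℚ[X]) =
      aeval y (X ^ 3 - X ^ 2 + 2 : ℚ[X]) * aeval x (X ^ 2 + 1 : ℚ[X]) := by
  rw [bev_M13] at h
  have h' : (2 * y ^ 3 + y ^ 2 + 4 + x * (y ^ 3 + 2) + x ^ 2 * y ^ 2 : ℚ) = 0 := by exact_mod_cast h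
  simp only [map_add, map_sub, map_pow, aeval_X, map_ofNat, map_one]
  linear_combination h'

/-- `(t³ + 2, t³ − t² + 2)` is a coprime pair over `ℚ`: `½(1 − t)·F₁ + ½t·F₂ = 1`. -/
theorem isCoprime_F_M13 : IsCoprime (X ^ 3 + 2 : ℚ[X]) (X ^ 3 - X ^ 2 + 2) := by
  refine ⟨Polynomial.C (1 / 2) * (1 - X), Polynomial.C (1 / 2) * X, ?_⟩
  have h2 : (2 : ℚ[X]) = Polynomial.C 2 := (map_ofNat Polynomial.C 2).symm
  calc Polynomial.C (1 / 2) * (1 - X) * (X ^ 3 + 2) + Polynomial.C (1 / 2) * X * (X ^ 3 - X ^ 2 + 2)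
      = Polynomial.C (1 / 2 : ℚ) * 2 := by ring
    _ = 1 := by rw [h2, ← C_mul]; norm_num

/-- `(t² + 1, t² + t + 3)` is a coprime pair over `ℚ`: `⅕(t − 1)·G₁ − ⅕(t − 2)·G₂ = 1`. -/
theorem isCoprime_G_M13 : IsCoprime (X ^ 2 + 1 : ℚ[X]) (X ^ 2 + X + 3) := by
  refine ⟨Polynomial.C (1 / 5) * (X - 1), -(Polynomial.C (1 / 5) * (X - 2)), ?_⟩
  have h5 : (5 : ℚ[X]) = Polynomial.C 5 := (map_ofNat Polynomial.C 5).symm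
  calc Polynomial.C (1 / 5) * (X - 1) * (X ^ 2 + 1) + -(Polynomial.C (1 / 5) * (X - 2)) * (X ^ 2 + X + 3)
      = Polynomial.C (1 / 5 : ℚ) * 5 := by ring
    _ = 1 := by rw [h5, ← C_mul]; norm_num

/-- `dF = max(deg F₁, deg F₂) = 3`. -/
theorem dF_M13 : max (X ^ 3 + 2 : ℚ[X]).natDegree (X ^ 3 - X ^ 2 + 2 : ℚ[X]).natDegree = 3 := by
  have h1 : (X ^ 3 + 2 : ℚ[X]).natDegree = 3 := by compute_degree!
  have h2 : (X ^ 3 - X ^ 2 + 2 : ℚ[X]).natDegree = 3 := by compute_degree!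
  rw [h1, h2, max_self]

/-- `dG = max(deg G₁, deg G₂) = 2`. -/
theorem dG_M13 : max (X ^ 2 + 1 : ℚ[X]).natDegree (X ^ 2 + X + 3 : ℚ[X]).natDegree = 2 := by
  have h1 : (X ^ 2 + 1 : ℚ[X]).natDegree = 2 := by compute_degree!
  have h2 : (X ^ 2 + X + 3 : ℚ[X]).natDegree = 2 := by compute_degree!
  rw [h1, h2, max_self]

/-- **`M13` IS DECIDED AT EVERY `m₀ ≥ 2`, HYPOTHESIS-FREE** (THEOREM A⁺: `dF = 3 < 2·m₀`). -/
theorem thinFibreAt_M13 {m₀ : ℕ} (hm : 2 ≤ m₀) : ThinFibreAt m₀ M13 :=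
  thinFibreAt_of_corr isCoprime_F_M13 isCoprime_G_M13 rel_M13 dF_M13 dG_M13 (by omega)

/-- `M13 ∈ CorrAt 2`. -/
theorem corrAt_two_M13 : CorrAt 2 M13 :=
  ⟨_, _, _, _, isCoprime_F_M13, isCoprime_G_M13, by rw [dF_M13, dG_M13]; norm_num, rel_M13⟩

/-! #### The costume test: `M13` is in NO tree class decided at `m₀ = 2` or `3`, NOT in node 11's class, and node 12
reaches it only modulo `HeightComparison` -/

/-- `¬ M13.natDegree < 3` (so the degree ladder fails at `m₀ = 2, 3`). -/
theorem not_natDegree_M13_lt_three : ¬ M13.natDegree < 3 := by rw [natDegree_M13]; norm_num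

/-- `M13` has NO x-linear presentation (`x`-degree `2`; values `7, 11, 17` at `y = 1`, `x = 0, 1, 2`). -/
theorem M13_ne_xLinP (A B : ℤ[X]) : M13 ≠ xLinP A B := by
  intro hP
  have h := fun x : ℝ => congrArg (fun Q => bev Q x 1) hP
  simp only [bev_M13, bev_xLinP] at h
  have h0 := h 0
  have h1 := h 1
  have h2 := h 2
  norm_num at h0 h1 h2
  linarith

/-- `¬ XLinearLt M13`. -/
theorem not_xLinearLt_M13 : ¬ XLinearLt M13 := fun ⟨A, B, _, _, hP⟩ => M13_ne_xLinP A B hP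

/-- the separable x-linear disjunct fails at every `m₀` (no x-linear presentation). -/
theorem not_xLinear_sep_M13 (m₀ : ℕ) :
    ¬ (3 ≤ m₀ ∧ ∃ A B : ℤ[X], (B.map (Int.castRingHom ℚ)).Separable ∧ M13 = xLinP A B) :=
  fun ⟨_, A, B, _, hP⟩ => M13_ne_xLinP A B hP

/-- in EVERY presentation `M13 = Σ_{j ≤ k} x^j c_j(Y)` the top `x`-coefficient has the root `0 ∈ ℚ₂` (it is `Y²`
or `0`). -/
theorem aeval_zero_top_of_M13_eq (k : ℕ) (c : ℕ → ℤ[X]) (h : M13 = xPolyP k c) : aeval (0 : ℚ_[2]) (c k) = 0 := by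
  have hc : ∀ i j : ℕ, (if j ∈ Finset.range 3 then (m13C j).coeff i else 0) =
      (if j ∈ Finset.range (k + 1) then (c j).coeff i else 0) := by
    intro i j
    rw [← coeff_coeff_xPolyP, ← coeff_coeff_xPolyP, ← h]; rfl
  rcases lt_trichotomy k 2 with hk | rfl | hk
  · exfalso
    have h22 := hc 2 2
    rw [if_pos (by simp), if_neg (by simp; omega), m13C_two, coeff_X_pow] at h22
    norm_num at h22
  · have hc2 : c 2 = m13C 2 := by
      ext i
      have := hc i 2
      rw [if_pos (by simp), if_pos (by simp)] at this
      exact this.symm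
    rw [hc2, m13C_two, map_pow, aeval_X, zero_pow two_ne_zero]
  · have hck : c k = 0 := by
      ext i
      have := hc i k
      rw [if_neg (by simp; omega), if_pos (by simp)] at this
      rw [coeff_zero]; exact this.symm
    rw [hck, map_zero]

/-- `¬ RootlessTop e M13` for EVERY `e` (the top has a root in `ℚ₂`). -/
theorem not_rootlessTop_M13 (e : ℕ) : ¬ RootlessTop e M13 := by
  rintro ⟨k, c, _, hroot, hP⟩
  exact hroot 0 (aeval_zero_top_of_M13_eq k c hP)

/-- `muTop M13 = 2` (the double root `0` of `Y²` in `ℂ₂`). -/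
theorem muTop_M13 : muTop M13 = 2 := by
  refine le_antisymm ?_ ?_
  · have := muTop_le_natDegree M13
    rwa [topX_M13, natDegree_m13C_two] at this
  · have h := rootMultiplicity_le_muTop M13 0
    rw [topX_M13, m13C_two, Polynomial.map_pow, map_X] at h
    have h2 : rootMultiplicity (0 : PadicAlgCl 2) (X ^ 2) = 2 := by
      simpa using rootMultiplicity_X_sub_C_pow (0 : PadicAlgCl 2) 2
    omega

/-- `eTop M13 = 1` (`deg_Y − deg c₂ = 3 − 2`). -/
theorem eTop_M13 : eTop M13 = 1 := by
  rw [eTop, topX_M13, natDegree_M13, natDegree_m13C_two]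

/-- **the tree's threshold EVALUATED: `thinThreshold M13 = 5`** — `thinFibreAt_all` reaches `M13` only at `m₀ ≥ 5`. -/
theorem thinThreshold_M13 : thinThreshold M13 = 5 := by
  rw [thinThreshold, muTop_M13, eTop_M13]; omega

/-- `¬ thinThreshold M13 ≤ 3` (hence `¬ ≤ 2`). -/
theorem not_thinThreshold_M13_le_three : ¬ thinThreshold M13 ≤ 3 := by rw [thinThreshold_M13]; norm_num

/-- **`M13` is in NO class decided at `m₀ = 2`** (each disjunct of `DecidedAt 2` refuted by name). -/
theorem not_decidedAt_two_M13 : ¬ DecidedAt 2 M13 := by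
  rintro (h | h | h | h | h)
  · exact not_natDegree_M13_lt_three (by omega)
  · exact not_xLinearLt_M13 h
  · exact not_xLinear_sep_M13 2 h
  · exact not_thinThreshold_M13_le_three (by omega)
  · exact not_rootlessTop_M13 1 h

/-- **`M13` is in NO class decided at `m₀ = 3` either.** -/
theorem not_decidedAt_three_M13 : ¬ DecidedAt 3 M13 := by
  rintro (h | h | h | h | h)
  · exact not_natDegree_M13_lt_three h
  · exact not_xLinearLt_M13 h
  · exact not_xLinear_sep_M13 3 h
  · exact not_thinThreshold_M13_le_three h
  · exact not_rootlessTop_M13 2 h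

/-- the top `Y²` is NOT separable over `ℚ` … -/
theorem not_separable_topX_M13 : ¬ ((topX M13).map (Int.castRingHom ℚ)).Separable := by
  rw [topX_M13, m13C_two, Polynomial.map_pow, map_X]
  intro hsep
  have := (hsep.of_pow Polynomial.not_isUnit_X two_ne_zero).2
  norm_num at this

/-- … so **`M13` is NOT in node 11's subspace class `SepTopAt m₀`, at ANY `m₀`**. -/
theorem not_sepTopAt_M13 (m₀ : ℕ) : ¬ SepTopAt m₀ M13 := fun h => not_separable_topX_M13 h.1

/-- **COSTUME TEST BY NAME, summarised — and the member DECIDED, hypothesis-free**: `M13` lies in the open territory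
of record after node 12 at `m₀ = 2` AND `m₀ = 3` (`¬ DecidedAt`, `¬ SepTopAt` at any `m₀`, `¬ RootlessTop e` at any
`e`; node 12's THEOREM A reaches it only modulo `HeightComparison`), and `ThinFibreAt m₀ M13` HOLDS for every
`m₀ ≥ 2` with NO hypothesis. -/
theorem M13_territory :
    ¬ DecidedAt 2 M13 ∧ ¬ DecidedAt 3 M13 ∧ (∀ m₀, ¬ SepTopAt m₀ M13) ∧ (∀ e, ¬ RootlessTop e M13) ∧
      ∀ m₀, 2 ≤ m₀ → ThinFibreAt m₀ M13 :=
  ⟨not_decidedAt_two_M13, not_decidedAt_three_M13, not_sepTopAt_M13, not_rootlessTop_M13,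
    fun _ hm => thinFibreAt_M13 hm⟩

end Summit.Schanuel.Schanuel.Theorems.RootDecomp1KHeightMachine

end
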